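import Summits.BirchSwinnertonDyer.BirchSwinnertonDyer.Theorems.AlignedTransportAtTwoMainConjectureOfRankZeroBSDAtTwoCubicChevalleySelmerBit
import Summits.BirchSwinnertonDyer.BirchSwinnertonDyer.Theorems.AlignedTransportAtTwoMainConjectureOfRankZeroBSDAtTwoSelmerTwoOfBSDp
import HarnessLib

/-!
# Route `AlignedTransportAtTwo`, crux C2 `MainConjectureOfRankZeroBSDAtTwo` (stmt-BirchSwinnertonDyer-22298):
# THE CLASS-NUMBER BIT OF THE CUBIC CHEVALLEY ROAD IS THE CRUX'S OWN HYPOTHESIS `BSD₂(W)` READ AT ONE RATIONAL NUMBER —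
# `MC₂(W)` ⟸ PRINT⁵ + `hYY` + MuIneqʳ + cell binders + off the stratum + `Odd (∏ c_v)` + «`ord₂(L(W,1)/Ω_W) = 0`» + integer unit certificates

HONEST FRAMING (cell `bsd-f1-sign2`, WIDTH-5 attached prover seat `bsd-line-att-p5` gen 30 on line `birth` of the lead `bsd-line-att-p2`;
`--supports` stmt-BirchSwinnertonDyer-22298, closes nothing; BSD is NOT proved by any of this; the crux C2, its verdict «blocked-on
`Rank1Residual.GreenbergMuConjectureIrreducible`» and every registered stub are untouched). THEOREMS ONLY (no definition, no named fact, no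
`sorry`). Sequel of att-p5 g29 `…CubicChevalleySelmerBit` and of this gen's `…SelmerTwoOfBSDp`: g29's class-group-free off-stratum door
displays `hSel : Sel₂(W/ℚ) = ⊥`; `…SelmerTwoOfBSDp.selmerGroup_two_eq_bot_of_bsdp` derives it from the crux's OWN hypothesis
`hbsd : BSDp W 2` with `r_an(W) = 0`, the binder `ht` (no rational `2`-torsion abscissa), `Odd (∏_v c_v)` and ONE rational number —
`L(W,1)/Ω_W = q ≠ 0` with `ord₂ q = 0` (equivalently Zhai's `ord₂ L^{alg}(W,1) = 0`, `Ω_∞ = Ω_W` on `Δ_W < 0`; equivalently `ord₂ #Ш_an = 0`).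

WHAT.
* `classicalMuVanishes_adjoin_of_lValue_unit_of_unitCerts_of_not_onKilfordStratumAtTwo`: `μ₂(ℚ(β)^{cyc}) = 0` OFF the stratum from
  `hYY` + `BSD₂(W)` + `r_an = 0` + `ht` + `Odd (∏ c_v)` + odd `L(W,1)/Ω_W` + the unit's integer certificates.
* **`mazurMainConjecture_two_of_muIneqRel_of_lValue_unit_of_unitCerts_of_not_onKilfordStratumAtTwo`**: `MC₂(W)` ⟸ PRINT⁵ + `hYY` + MuIneqʳ
  (registered stub verbatim) + the crux's cell binders (`hord`, `ht`, `hΔ`, `hr`, `hμan`, `hbsd`) + OFF the stratum + `Odd (∏_v c_v)` +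
  «`ord₂(L(W,1)/Ω_W) = 0`» + integers; `…_muFree`: `hμan` discharged (bsd-2adic `AnalyticMuTwo.red_ne_zero_…`); `…_of_isLAlg…`: the same two in
  Zhai's `L^{alg}` currency (the X5 table's column).

READING (for the planner-of-record / -data). On the sub-cell {good ordinary at `2`, `E(ℚ)[2] = 0`, `Δ_W < 0`, off the Kilford stratum,
`r_an = 0`, `∏ c_v` odd} the cubic `(0,1)`-Chevalley road now displays, besides PRINT⁵ + `hYY` + MuIneqʳ and C2's own `BSD₂(W)`:
ONE BIT OF THE `L`-VALUE (`ord₂(L(W,1)/Ω_W) = 0`, read off the X5 table) and the `2`-ADIC SIGN OF ONE UNIT of `ℚ(β)` (integers). By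
`…SelmerTwoOfBSDp` §5 the `L`-value bit is also NECESSARY for `Sel₂(W/ℚ) = ⊥` under `BSD₂(W)`. CONDITIONAL theorems (PRINT⁵, `hYY`, MuIneqʳ
displayed); nothing is asserted about any curve; nothing is closed; BSD is not proved.

References: [YooYu2022] Thm. 1.6 with 1.4 / 1.10 / 1.11 (1) / §1; [Miller2011LMS] Def. 1.1; [SilvermanAEC2009] Thm. X.4.2 (a); [Zhai2016] §1;
[Kato2004Asterisque] Thm. 17.4; [GreenbergLNM1716] Thm. 4.1; tree: att-p5 g29 `…CubicChevalleySelmerBit`, g30 `…SelmerTwoOfBSDp`.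
-/

set_option linter.dupNamespace false
set_option autoImplicit false

noncomputable section

open scoped Classical NumberField nonZeroDivisors IntermediateField

namespace Summit.BirchSwinnertonDyer.BirchSwinnertonDyer.Theorems.AlignedTransportAtTwoCubicChevalleyLValueBit

open NumberField IsDedekindDomain Polynomial WeierstrassCurve IntermediateField CongruenceSubgroup
  Literature.NumberTheory.IwasawaTheory Literature.NumberTheory.GaloisRepresentations
  Literature.NumberTheory.EllipticCurves Literature.NumberTheory.EllipticCurves.Greenberg1999
  Literature.NumberTheory.EllipticCurves.ModularForms Literature.NumberTheory.EllipticCurves.Rank1Residual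
  Literature.NumberTheory.EllipticCurves.Module Literature.NumberTheory.EllipticCurves.Zhai2016
  Summit.BirchSwinnertonDyer.Rank1Residual Summit.BirchSwinnertonDyer.Rank1Residual.X1.MuLambda
  Summit.BirchSwinnertonDyer.Rank1Residual.X5 Summit.BirchSwinnertonDyer.Rank1Residual.F1Sign2
  Summit.BirchSwinnertonDyer.BirchSwinnertonDyer.Theorems.Rank1ResidualX1Defs
  Summit.BirchSwinnertonDyer.BirchSwinnertonDyer.Theses.AlignedTransportAtTwo
  Summit.BirchSwinnertonDyer.BirchSwinnertonDyer.Theorems.AlignedTransportAtTwoCubicChevalleySelmerBit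
  Summit.BirchSwinnertonDyer.BirchSwinnertonDyer.Theorems.AlignedTransportAtTwoSelmerTwoOfBSDp

variable (W : WeierstrassCurve ℚ) [W.IsElliptic] [W.IsGloballyMinimal]

/-- **`μ₂(ℚ(β)^{cyc}) = 0` OFF THE STRATUM FROM `BSD₂(W)` AND ONE ODD `L`-VALUE.** `hYY` (Brumer–Kramer/Yoo–Yu) turns `2 ∤ h(ℚ(β))` into
`Sel₂(W/ℚ) = ⊥`, which `…SelmerTwoOfBSDp.selmerGroup_two_eq_bot_of_bsdp` derives from `BSDp W 2`, `r_an = 0`, `ht`, `Odd (∏ c_v)` and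
`L(W,1)/Ω_W = q ≠ 0`, `ord₂ q = 0`; the unit bit is the integer certificate (g29). [cite: YooYu2022, Thm. 1.6 with Thm. 1.10 and 1.11]
[cite: Miller2011LMS, Def. 1.1] [cite: SilvermanAEC2009, Thm. X.4.2 (a)] [cite: Lang1990, Ch. 13 §4, Lemma 4.1] -/
theorem classicalMuVanishes_adjoin_of_lValue_unit_of_unitCerts_of_not_onKilfordStratumAtTwo
    (hYY : yooYu_selmerTwo_eq_bot_oddClassNumber_cubicTwoTorsionField)
    (hord : IsOrdinaryAt W 2) (ht : ∀ x : ℚ, ¬ HasRationalTwoTorsionX W x) (hΔ : W.Δ < 0) (hs : ¬ OnKilfordStratumAtTwo W)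
    (htam : Odd W.tamagawaProduct)
    (hr : W.analyticRank = 0) (hbsd : BSDp W 2)
    (hL : ∃ q : ℚ, q ≠ 0 ∧ W.entireLFunction 1 / (W.realPeriodRat : ℂ) = (q : ℂ) ∧ padicValRat 2 q = 0)
    {β : AlgebraicClosure ℚ} (hβ : aeval β W.twoTorsionPolynomial.toPoly = 0)
    (P : ℤ[X]) (k : ℕ) (m m' a c T S sgn : ℤ) (hsgn : sgn = 1 ∨ sgn = -1)
    (hid : (aeval (4 * (AdjoinSimple.gen ℚ β : ↥(IntermediateField.adjoin ℚ ({β} : Set (AlgebraicClosure ℚ)))))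
          (P.map (Int.castRingHom ℚ)) / (2 ^ k * (m : ↥(IntermediateField.adjoin ℚ ({β} : Set (AlgebraicClosure ℚ)))))) ^ 3
        - T * (aeval (4 * (AdjoinSimple.gen ℚ β : ↥(IntermediateField.adjoin ℚ ({β} : Set (AlgebraicClosure ℚ)))))
          (P.map (Int.castRingHom ℚ)) / (2 ^ k * (m : ↥(IntermediateField.adjoin ℚ ({β} : Set (AlgebraicClosure ℚ)))))) ^ 2
        + S * (aeval (4 * (AdjoinSimple.gen ℚ β : ↥(IntermediateField.adjoin ℚ ({β} : Set (AlgebraicClosure ℚ)))))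
          (P.map (Int.castRingHom ℚ)) / (2 ^ k * (m : ↥(IntermediateField.adjoin ℚ ({β} : Set (AlgebraicClosure ℚ))))))
        - sgn = 0)
    (hc : c = 3 ∨ c = 5) (ha : Odd a)
    (hroot : (2 : ℤ) ^ (k + 3) ∣
      a ^ 3 + (integralModelInt W).b₂ * a ^ 2 + 8 * (integralModelInt W).b₄ * a + 16 * (integralModelInt W).b₆)
    (hmm : ((m * m' : ℤ) : ZMod (2 ^ 3)) = 1)
    (hcert : ((P.eval a * m' : ℤ) : ZMod (2 ^ (k + 3))) = ((2 ^ k * c : ℤ) : ZMod (2 ^ (k + 3))))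
    (κP : ZpExtension ↥(IntermediateField.adjoin ℚ ({β} : Set (AlgebraicClosure ℚ))) 2) (hκP : κP.IsCyclotomic) :
    ClassicalMuVanishes κP :=
  classicalMuVanishes_adjoin_of_selmerTwo_eq_bot_of_unitCerts_of_not_onKilfordStratumAtTwo W hYY hord ht hΔ hs htam
    (selmerGroup_two_eq_bot_of_bsdp W hbsd hr ht htam hL) hβ P k m m' a c T S sgn hsgn hid hc ha hroot hmm hcert κP hκP

/-- **THE OFF-STRATUM CUBIC DOOR INTO `MC₂(W)`, KEYED BY ONE ODD `L`-VALUE.** PRINT⁵ {Kato 17.4 (1)(2) at `2`, Greenberg 4.1, period unit,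
modularity, GZK} + `hYY` + MuIneqʳ (`hI`, the registered stub VERBATIM) + the crux's cell hypotheses (good ordinary at `2`, no rational
`2`-torsion abscissa, `Δ_W < 0`, `r_an = 0`, analytic `μ₂ = 0` on the even branch, **`BSD₂(W)`**) + OFF the Kilford stratum + `Odd (∏_v c_v)` +
**`L(W,1)/Ω_W = q ≠ 0` with `ord₂ q = 0`** + `β` a root of the `2`-division cubic + the INTEGER certificates `(P, k, m, m', a, c, T, S, sgn)` of one
unit of `ℚ(β)` ⟹ `MC₂(W)`. No class group, no Selmer group. [cite: YooYu2022, Thm. 1.6 with Thm. 1.10 and 1.11]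
[cite: Kato2004Asterisque, Thm. 17.4 (1)(2) (p. 273)] [cite: GreenbergLNM1716, Thm. 4.1 (p. 102) and Conj. 1.11 (p. 58)] [cite: Miller2011LMS, Def. 1.1]
[cite: Fukuda1994, Thm. 1 (1), p. 264] [cite: Lang1990, Ch. 13 §4, Lemma 4.1] [cite: Serre1973, Ch. III §1.2 Thm. 1] -/
theorem mazurMainConjecture_two_of_muIneqRel_of_lValue_unit_of_unitCerts_of_not_onKilfordStratumAtTwo
    (h17 : ∀ [NeZero (W.conductorNorm ℤ)] (f : CuspForm (Gamma0 (W.conductorNorm ℤ)) 2),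
      kato_divisibility_allPrimes W 2 (f := f))
    (hGr : Greenberg1999.thm41_charValue_rankZero_anyPrime)
    (hper : realPeriodRat_eq_unit_mul_plusPeriod_two) (hmod : nonempty_modularParametrizationData)
    (hGZK : rank_eq_analyticRank_of_analyticRank_le_one)
    (hYY : yooYu_selmerTwo_eq_bot_oddClassNumber_cubicTwoTorsionField)
    (hI : ∀ (W : WeierstrassCurve ℚ) [W.IsElliptic] [W.IsGloballyMinimal], IsOrdinaryAt W 2 →
      (∀ x : ℚ, ¬ HasRationalTwoTorsionX W x) →
      ∀ (κ : ZpExtension ℚ 2) (γ : Field.absoluteGaloisGroup ℚ), κ.IsCyclotomic →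
      κ.IsTopGenerator γ → IsCyclotomicVariable 2 γ →
      ∀ ⦃N : ℕ⦄ [NeZero N] (f : CuspForm (Gamma0 N) 2), IsNewformOf W f →
      ∀ Gp : IwasawaAlgebra 2, iwasawaToPowerSeries 2 Gp = padicLFunction f (unitRoot W 2 : ℚ_[2]) →
      ∀ (D : W.SelmerDualData κ γ) (Yr : W.FineSelmerDualDataRelaxedInf κ γ),
        lengthAt (IwasawaAlgebra 2) D.X ⟨IwasawaAlgebra.augIdealP 2, IwasawaAlgebra.isPrime_augIdealP_holds 2⟩ ≤
          lengthAt (IwasawaAlgebra 2) (IwasawaAlgebra 2 ⧸ Ideal.span {Gp})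
              ⟨IwasawaAlgebra.augIdealP 2, IwasawaAlgebra.isPrime_augIdealP_holds 2⟩ +
            lengthAt (IwasawaAlgebra 2) Yr.X ⟨IwasawaAlgebra.augIdealP 2, IwasawaAlgebra.isPrime_augIdealP_holds 2⟩)
    (hord : IsOrdinaryAt W 2) (ht : ∀ x : ℚ, ¬ HasRationalTwoTorsionX W x) (hΔ : W.Δ < 0) (hr : W.analyticRank = 0)
    (hμan : ∀ ⦃N : ℕ⦄ [NeZero N] (f : CuspForm (Gamma0 N) 2), IsNewformOf W f →
      ∀ G : IwasawaAlgebra 2, IsEvenBranchLiftAtTwo W f G → red G ≠ 0)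
    (hbsd : BSDp W 2) (hs : ¬ OnKilfordStratumAtTwo W) (htam : Odd W.tamagawaProduct)
    (hL : ∃ q : ℚ, q ≠ 0 ∧ W.entireLFunction 1 / (W.realPeriodRat : ℂ) = (q : ℂ) ∧ padicValRat 2 q = 0)
    {β : AlgebraicClosure ℚ} (hβ : aeval β W.twoTorsionPolynomial.toPoly = 0)
    (P : ℤ[X]) (k : ℕ) (m m' a c T S sgn : ℤ) (hsgn : sgn = 1 ∨ sgn = -1)
    (hid : (aeval (4 * (AdjoinSimple.gen ℚ β : ↥(IntermediateField.adjoin ℚ ({β} : Set (AlgebraicClosure ℚ)))))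
          (P.map (Int.castRingHom ℚ)) / (2 ^ k * (m : ↥(IntermediateField.adjoin ℚ ({β} : Set (AlgebraicClosure ℚ)))))) ^ 3
        - T * (aeval (4 * (AdjoinSimple.gen ℚ β : ↥(IntermediateField.adjoin ℚ ({β} : Set (AlgebraicClosure ℚ)))))
          (P.map (Int.castRingHom ℚ)) / (2 ^ k * (m : ↥(IntermediateField.adjoin ℚ ({β} : Set (AlgebraicClosure ℚ)))))) ^ 2
        + S * (aeval (4 * (AdjoinSimple.gen ℚ β : ↥(IntermediateField.adjoin ℚ ({β} : Set (AlgebraicClosure ℚ)))))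
          (P.map (Int.castRingHom ℚ)) / (2 ^ k * (m : ↥(IntermediateField.adjoin ℚ ({β} : Set (AlgebraicClosure ℚ))))))
        - sgn = 0)
    (hc : c = 3 ∨ c = 5) (ha : Odd a)
    (hroot : (2 : ℤ) ^ (k + 3) ∣
      a ^ 3 + (integralModelInt W).b₂ * a ^ 2 + 8 * (integralModelInt W).b₄ * a + 16 * (integralModelInt W).b₆)
    (hmm : ((m * m' : ℤ) : ZMod (2 ^ 3)) = 1)
    (hcert : ((P.eval a * m' : ℤ) : ZMod (2 ^ (k + 3))) = ((2 ^ k * c : ℤ) : ZMod (2 ^ (k + 3)))) :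
    MazurMainConjecture W 2 :=
  mazurMainConjecture_two_of_muIneqRel_of_selmerTwo_eq_bot_of_unitCerts_of_not_onKilfordStratumAtTwo W h17 hGr hper hmod hGZK hYY hI hord ht
    hΔ hr hμan hbsd hs htam (selmerGroup_two_eq_bot_of_bsdp W hbsd hr ht htam hL) hβ P k m m' a c T S sgn hsgn hid hc ha hroot hmm hcert

/-- **THE SAME DOOR, `hμan`-FREE** (bsd-2adic `AnalyticMuTwo.red_ne_zero_of_isEvenBranchLiftAtTwo_of_forall_not_hasRationalTwoTorsionX`). Displayed:
PRINT⁵ + `hYY` + MuIneqʳ + cell binders (`hord`, `ht`, `hΔ`, `hr`, `hbsd`) + OFF the stratum + `Odd (∏_v c_v)` + «`ord₂(L(W,1)/Ω_W) = 0`» + integers.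
[cite: YooYu2022, Thm. 1.6 with Thm. 1.10 and 1.11] [cite: Kato2004Asterisque, Thm. 17.4 (1)(2) (p. 273)] [cite: GreenbergLNM1716, Thm. 4.1 (p. 102)]
[cite: Miller2011LMS, Def. 1.1] [cite: Fukuda1994, Thm. 1 (1), p. 264] [cite: Lang1990, Ch. 13 §4, Lemma 4.1] -/
theorem mazurMainConjecture_two_of_muIneqRel_of_lValue_unit_of_unitCerts_muFree
    (h17 : ∀ [NeZero (W.conductorNorm ℤ)] (f : CuspForm (Gamma0 (W.conductorNorm ℤ)) 2),
      kato_divisibility_allPrimes W 2 (f := f))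
    (hGr : Greenberg1999.thm41_charValue_rankZero_anyPrime)
    (hper : realPeriodRat_eq_unit_mul_plusPeriod_two) (hmod : nonempty_modularParametrizationData)
    (hGZK : rank_eq_analyticRank_of_analyticRank_le_one)
    (hYY : yooYu_selmerTwo_eq_bot_oddClassNumber_cubicTwoTorsionField)
    (hI : ∀ (W : WeierstrassCurve ℚ) [W.IsElliptic] [W.IsGloballyMinimal], IsOrdinaryAt W 2 →
      (∀ x : ℚ, ¬ HasRationalTwoTorsionX W x) →
      ∀ (κ : ZpExtension ℚ 2) (γ : Field.absoluteGaloisGroup ℚ), κ.IsCyclotomic →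
      κ.IsTopGenerator γ → IsCyclotomicVariable 2 γ →
      ∀ ⦃N : ℕ⦄ [NeZero N] (f : CuspForm (Gamma0 N) 2), IsNewformOf W f →
      ∀ Gp : IwasawaAlgebra 2, iwasawaToPowerSeries 2 Gp = padicLFunction f (unitRoot W 2 : ℚ_[2]) →
      ∀ (D : W.SelmerDualData κ γ) (Yr : W.FineSelmerDualDataRelaxedInf κ γ),
        lengthAt (IwasawaAlgebra 2) D.X ⟨IwasawaAlgebra.augIdealP 2, IwasawaAlgebra.isPrime_augIdealP_holds 2⟩ ≤
          lengthAt (IwasawaAlgebra 2) (IwasawaAlgebra 2 ⧸ Ideal.span {Gp})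
              ⟨IwasawaAlgebra.augIdealP 2, IwasawaAlgebra.isPrime_augIdealP_holds 2⟩ +
            lengthAt (IwasawaAlgebra 2) Yr.X ⟨IwasawaAlgebra.augIdealP 2, IwasawaAlgebra.isPrime_augIdealP_holds 2⟩)
    (hord : IsOrdinaryAt W 2) (ht : ∀ x : ℚ, ¬ HasRationalTwoTorsionX W x) (hΔ : W.Δ < 0) (hr : W.analyticRank = 0)
    (hbsd : BSDp W 2) (hs : ¬ OnKilfordStratumAtTwo W) (htam : Odd W.tamagawaProduct)
    (hL : ∃ q : ℚ, q ≠ 0 ∧ W.entireLFunction 1 / (W.realPeriodRat : ℂ) = (q : ℂ) ∧ padicValRat 2 q = 0)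
    {β : AlgebraicClosure ℚ} (hβ : aeval β W.twoTorsionPolynomial.toPoly = 0)
    (P : ℤ[X]) (k : ℕ) (m m' a c T S sgn : ℤ) (hsgn : sgn = 1 ∨ sgn = -1)
    (hid : (aeval (4 * (AdjoinSimple.gen ℚ β : ↥(IntermediateField.adjoin ℚ ({β} : Set (AlgebraicClosure ℚ)))))
          (P.map (Int.castRingHom ℚ)) / (2 ^ k * (m : ↥(IntermediateField.adjoin ℚ ({β} : Set (AlgebraicClosure ℚ)))))) ^ 3
        - T * (aeval (4 * (AdjoinSimple.gen ℚ β : ↥(IntermediateField.adjoin ℚ ({β} : Set (AlgebraicClosure ℚ)))))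
          (P.map (Int.castRingHom ℚ)) / (2 ^ k * (m : ↥(IntermediateField.adjoin ℚ ({β} : Set (AlgebraicClosure ℚ)))))) ^ 2
        + S * (aeval (4 * (AdjoinSimple.gen ℚ β : ↥(IntermediateField.adjoin ℚ ({β} : Set (AlgebraicClosure ℚ)))))
          (P.map (Int.castRingHom ℚ)) / (2 ^ k * (m : ↥(IntermediateField.adjoin ℚ ({β} : Set (AlgebraicClosure ℚ))))))
        - sgn = 0)
    (hc : c = 3 ∨ c = 5) (ha : Odd a)
    (hroot : (2 : ℤ) ^ (k + 3) ∣
      a ^ 3 + (integralModelInt W).b₂ * a ^ 2 + 8 * (integralModelInt W).b₄ * a + 16 * (integralModelInt W).b₆)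
    (hmm : ((m * m' : ℤ) : ZMod (2 ^ 3)) = 1)
    (hcert : ((P.eval a * m' : ℤ) : ZMod (2 ^ (k + 3))) = ((2 ^ k * c : ℤ) : ZMod (2 ^ (k + 3)))) :
    MazurMainConjecture W 2 :=
  mazurMainConjecture_two_of_muIneqRel_of_lValue_unit_of_unitCerts_of_not_onKilfordStratumAtTwo W h17 hGr hper hmod hGZK hYY hI hord ht hΔ hr
    (AnalyticMuTwo.red_ne_zero_of_isEvenBranchLiftAtTwo_of_forall_not_hasRationalTwoTorsionX W hord ht) hbsd hs htam hL hβ P k m m' a c T S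
    sgn hsgn hid hc ha hroot hmm hcert

/-! ## Zhai currency: «`ord₂ L^{alg}(W,1) = 0`» (`IsLAlg`, `Ω_∞ = Ω_W` on `Δ_W < 0`) -/

/-- **THE OFF-STRATUM CUBIC DOOR INTO `MC₂(W)` IN ZHAI'S CURRENCY**: as `…_of_lValue_unit_…` with the `L`-value datum as
`∃ x, IsLAlg W x ∧ x ≠ 0 ∧ ord₂ x = 0` (the X5 table's column «`v₂(L/Ω_∞) = 0`»; `Ω_∞ = Ω_W` since `Δ_W < 0`).
[cite: Zhai2016, §1 (L^{alg}, Ω_∞)] [cite: YooYu2022, Thm. 1.6 with Thm. 1.10 and 1.11] [cite: Kato2004Asterisque, Thm. 17.4 (1)(2) (p. 273)]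
[cite: GreenbergLNM1716, Thm. 4.1 (p. 102) and Conj. 1.11 (p. 58)] [cite: Miller2011LMS, Def. 1.1] [cite: Lang1990, Ch. 13 §4, Lemma 4.1] -/
theorem mazurMainConjecture_two_of_muIneqRel_of_isLAlg_unit_of_unitCerts_of_not_onKilfordStratumAtTwo
    (h17 : ∀ [NeZero (W.conductorNorm ℤ)] (f : CuspForm (Gamma0 (W.conductorNorm ℤ)) 2),
      kato_divisibility_allPrimes W 2 (f := f))
    (hGr : Greenberg1999.thm41_charValue_rankZero_anyPrime)
    (hper : realPeriodRat_eq_unit_mul_plusPeriod_two) (hmod : nonempty_modularParametrizationData)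
    (hGZK : rank_eq_analyticRank_of_analyticRank_le_one)
    (hYY : yooYu_selmerTwo_eq_bot_oddClassNumber_cubicTwoTorsionField)
    (hI : ∀ (W : WeierstrassCurve ℚ) [W.IsElliptic] [W.IsGloballyMinimal], IsOrdinaryAt W 2 →
      (∀ x : ℚ, ¬ HasRationalTwoTorsionX W x) →
      ∀ (κ : ZpExtension ℚ 2) (γ : Field.absoluteGaloisGroup ℚ), κ.IsCyclotomic →
      κ.IsTopGenerator γ → IsCyclotomicVariable 2 γ →
      ∀ ⦃N : ℕ⦄ [NeZero N] (f : CuspForm (Gamma0 N) 2), IsNewformOf W f →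
      ∀ Gp : IwasawaAlgebra 2, iwasawaToPowerSeries 2 Gp = padicLFunction f (unitRoot W 2 : ℚ_[2]) →
      ∀ (D : W.SelmerDualData κ γ) (Yr : W.FineSelmerDualDataRelaxedInf κ γ),
        lengthAt (IwasawaAlgebra 2) D.X ⟨IwasawaAlgebra.augIdealP 2, IwasawaAlgebra.isPrime_augIdealP_holds 2⟩ ≤
          lengthAt (IwasawaAlgebra 2) (IwasawaAlgebra 2 ⧸ Ideal.span {Gp})
              ⟨IwasawaAlgebra.augIdealP 2, IwasawaAlgebra.isPrime_augIdealP_holds 2⟩ +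
            lengthAt (IwasawaAlgebra 2) Yr.X ⟨IwasawaAlgebra.augIdealP 2, IwasawaAlgebra.isPrime_augIdealP_holds 2⟩)
    (hord : IsOrdinaryAt W 2) (ht : ∀ x : ℚ, ¬ HasRationalTwoTorsionX W x) (hΔ : W.Δ < 0) (hr : W.analyticRank = 0)
    (hμan : ∀ ⦃N : ℕ⦄ [NeZero N] (f : CuspForm (Gamma0 N) 2), IsNewformOf W f →
      ∀ G : IwasawaAlgebra 2, IsEvenBranchLiftAtTwo W f G → red G ≠ 0)
    (hbsd : BSDp W 2) (hs : ¬ OnKilfordStratumAtTwo W) (htam : Odd W.tamagawaProduct)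
    (hL : ∃ x : ℚ, IsLAlg W x ∧ x ≠ 0 ∧ padicValRat 2 x = 0)
    {β : AlgebraicClosure ℚ} (hβ : aeval β W.twoTorsionPolynomial.toPoly = 0)
    (P : ℤ[X]) (k : ℕ) (m m' a c T S sgn : ℤ) (hsgn : sgn = 1 ∨ sgn = -1)
    (hid : (aeval (4 * (AdjoinSimple.gen ℚ β : ↥(IntermediateField.adjoin ℚ ({β} : Set (AlgebraicClosure ℚ)))))
          (P.map (Int.castRingHom ℚ)) / (2 ^ k * (m : ↥(IntermediateField.adjoin ℚ ({β} : Set (AlgebraicClosure ℚ)))))) ^ 3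
        - T * (aeval (4 * (AdjoinSimple.gen ℚ β : ↥(IntermediateField.adjoin ℚ ({β} : Set (AlgebraicClosure ℚ)))))
          (P.map (Int.castRingHom ℚ)) / (2 ^ k * (m : ↥(IntermediateField.adjoin ℚ ({β} : Set (AlgebraicClosure ℚ)))))) ^ 2
        + S * (aeval (4 * (AdjoinSimple.gen ℚ β : ↥(IntermediateField.adjoin ℚ ({β} : Set (AlgebraicClosure ℚ)))))
          (P.map (Int.castRingHom ℚ)) / (2 ^ k * (m : ↥(IntermediateField.adjoin ℚ ({β} : Set (AlgebraicClosure ℚ))))))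
        - sgn = 0)
    (hc : c = 3 ∨ c = 5) (ha : Odd a)
    (hroot : (2 : ℤ) ^ (k + 3) ∣
      a ^ 3 + (integralModelInt W).b₂ * a ^ 2 + 8 * (integralModelInt W).b₄ * a + 16 * (integralModelInt W).b₆)
    (hmm : ((m * m' : ℤ) : ZMod (2 ^ 3)) = 1)
    (hcert : ((P.eval a * m' : ℤ) : ZMod (2 ^ (k + 3))) = ((2 ^ k * c : ℤ) : ZMod (2 ^ (k + 3)))) :
    MazurMainConjecture W 2 :=
  mazurMainConjecture_two_of_muIneqRel_of_selmerTwo_eq_bot_of_unitCerts_of_not_onKilfordStratumAtTwo W h17 hGr hper hmod hGZK hYY hI hord ht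
    hΔ hr hμan hbsd hs htam (selmerGroup_two_eq_bot_of_bsdp_of_isLAlg W hΔ hbsd hr ht htam hL) hβ P k m m' a c T S sgn hsgn hid hc ha hroot
    hmm hcert

/-- **THE ZHAI-CURRENCY DOOR, `hμan`-FREE.** Displayed: PRINT⁵ + `hYY` + MuIneqʳ + cell binders (`hord`, `ht`, `hΔ`, `hr`, `hbsd`) + OFF the stratum +
`Odd (∏_v c_v)` + «`ord₂ L^{alg}(W,1) = 0`» + integers. [cite: Zhai2016, §1] [cite: YooYu2022, Thm. 1.6 with Thm. 1.10 and 1.11]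
[cite: Kato2004Asterisque, Thm. 17.4 (1)(2) (p. 273)] [cite: GreenbergLNM1716, Thm. 4.1 (p. 102)] [cite: Miller2011LMS, Def. 1.1]
[cite: Fukuda1994, Thm. 1 (1), p. 264] [cite: Lang1990, Ch. 13 §4, Lemma 4.1] -/
theorem mazurMainConjecture_two_of_muIneqRel_of_isLAlg_unit_of_unitCerts_muFree
    (h17 : ∀ [NeZero (W.conductorNorm ℤ)] (f : CuspForm (Gamma0 (W.conductorNorm ℤ)) 2),
      kato_divisibility_allPrimes W 2 (f := f))
    (hGr : Greenberg1999.thm41_charValue_rankZero_anyPrime)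
    (hper : realPeriodRat_eq_unit_mul_plusPeriod_two) (hmod : nonempty_modularParametrizationData)
    (hGZK : rank_eq_analyticRank_of_analyticRank_le_one)
    (hYY : yooYu_selmerTwo_eq_bot_oddClassNumber_cubicTwoTorsionField)
    (hI : ∀ (W : WeierstrassCurve ℚ) [W.IsElliptic] [W.IsGloballyMinimal], IsOrdinaryAt W 2 →
      (∀ x : ℚ, ¬ HasRationalTwoTorsionX W x) →
      ∀ (κ : ZpExtension ℚ 2) (γ : Field.absoluteGaloisGroup ℚ), κ.IsCyclotomic →
      κ.IsTopGenerator γ → IsCyclotomicVariable 2 γ →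
      ∀ ⦃N : ℕ⦄ [NeZero N] (f : CuspForm (Gamma0 N) 2), IsNewformOf W f →
      ∀ Gp : IwasawaAlgebra 2, iwasawaToPowerSeries 2 Gp = padicLFunction f (unitRoot W 2 : ℚ_[2]) →
      ∀ (D : W.SelmerDualData κ γ) (Yr : W.FineSelmerDualDataRelaxedInf κ γ),
        lengthAt (IwasawaAlgebra 2) D.X ⟨IwasawaAlgebra.augIdealP 2, IwasawaAlgebra.isPrime_augIdealP_holds 2⟩ ≤
          lengthAt (IwasawaAlgebra 2) (IwasawaAlgebra 2 ⧸ Ideal.span {Gp})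
              ⟨IwasawaAlgebra.augIdealP 2, IwasawaAlgebra.isPrime_augIdealP_holds 2⟩ +
            lengthAt (IwasawaAlgebra 2) Yr.X ⟨IwasawaAlgebra.augIdealP 2, IwasawaAlgebra.isPrime_augIdealP_holds 2⟩)
    (hord : IsOrdinaryAt W 2) (ht : ∀ x : ℚ, ¬ HasRationalTwoTorsionX W x) (hΔ : W.Δ < 0) (hr : W.analyticRank = 0)
    (hbsd : BSDp W 2) (hs : ¬ OnKilfordStratumAtTwo W) (htam : Odd W.tamagawaProduct)
    (hL : ∃ x : ℚ, IsLAlg W x ∧ x ≠ 0 ∧ padicValRat 2 x = 0)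
    {β : AlgebraicClosure ℚ} (hβ : aeval β W.twoTorsionPolynomial.toPoly = 0)
    (P : ℤ[X]) (k : ℕ) (m m' a c T S sgn : ℤ) (hsgn : sgn = 1 ∨ sgn = -1)
    (hid : (aeval (4 * (AdjoinSimple.gen ℚ β : ↥(IntermediateField.adjoin ℚ ({β} : Set (AlgebraicClosure ℚ)))))
          (P.map (Int.castRingHom ℚ)) / (2 ^ k * (m : ↥(IntermediateField.adjoin ℚ ({β} : Set (AlgebraicClosure ℚ)))))) ^ 3
        - T * (aeval (4 * (AdjoinSimple.gen ℚ β : ↥(IntermediateField.adjoin ℚ ({β} : Set (AlgebraicClosure ℚ)))))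
          (P.map (Int.castRingHom ℚ)) / (2 ^ k * (m : ↥(IntermediateField.adjoin ℚ ({β} : Set (AlgebraicClosure ℚ)))))) ^ 2
        + S * (aeval (4 * (AdjoinSimple.gen ℚ β : ↥(IntermediateField.adjoin ℚ ({β} : Set (AlgebraicClosure ℚ)))))
          (P.map (Int.castRingHom ℚ)) / (2 ^ k * (m : ↥(IntermediateField.adjoin ℚ ({β} : Set (AlgebraicClosure ℚ))))))
        - sgn = 0)
    (hc : c = 3 ∨ c = 5) (ha : Odd a)
    (hroot : (2 : ℤ) ^ (k + 3) ∣
      a ^ 3 + (integralModelInt W).b₂ * a ^ 2 + 8 * (integralModelInt W).b₄ * a + 16 * (integralModelInt W).b₆)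
    (hmm : ((m * m' : ℤ) : ZMod (2 ^ 3)) = 1)
    (hcert : ((P.eval a * m' : ℤ) : ZMod (2 ^ (k + 3))) = ((2 ^ k * c : ℤ) : ZMod (2 ^ (k + 3)))) :
    MazurMainConjecture W 2 :=
  mazurMainConjecture_two_of_muIneqRel_of_isLAlg_unit_of_unitCerts_of_not_onKilfordStratumAtTwo W h17 hGr hper hmod hGZK hYY hI hord ht hΔ hr
    (AnalyticMuTwo.red_ne_zero_of_isEvenBranchLiftAtTwo_of_forall_not_hasRationalTwoTorsionX W hord ht) hbsd hs htam hL hβ P k m m' a c T S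
    sgn hsgn hid hc ha hroot hmm hcert

end Summit.BirchSwinnertonDyer.BirchSwinnertonDyer.Theorems.AlignedTransportAtTwoCubicChevalleyLValueBit

end
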